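import Summits.BirchSwinnertonDyer.BirchSwinnertonDyer.Theorems.ManinLocalTwoThreeNaturalTes75Consumers
import Summits.BirchSwinnertonDyer.BirchSwinnertonDyer.Theorems.ManinLocalTwoThreeKummerValuesHalfIndex
import Literature.NumberTheory.EllipticCurves.ModularCurveManinSemistableBridgeProofs
import Literature.NumberTheory.EllipticCurves.PeriodLatticeGamma1QuotientProofs
import HarnessLib

/-!
# T-es-75♮ (the natural Stevens statement) ⟸ T-es-75 as typed ∧ «every newform has an OPTIMAL `X₁(N)`-datum somewhere» — the one bridge
(route `ManinLocalTwoThree`, crux C2 `ManinOddAtFour` stmt-BirchSwinnertonDyer-22967; cell bsd-f2-manin, prover seat p2 gen 23;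
`--supports stmt-BirchSwinnertonDyer-22967`; companion of `…NaturalTes75Consumers` (p2 gen 23) and of p3 gen 21's CES♭ programme)

`…NaturalTes75Consumers` showed that T-es-75 read WITHOUT the optimality binder (T-es-75♮) eliminates CES from every row of the cell.  THIS FILE
derives T-es-75♮ from the tree's T-es-75 (optimal data only) plus an OPTIMAL TWIN: for every `X₁(N)`-datum `D` of an elliptic `W/ℚ` some elliptic
`E₁/ℚ` carries an OPTIMAL `X₁(N)`-datum `D₁` with the same newform.  Transport: `Λ_{E₁} = c₁Λ₁(f)` and `cΛ₁(f) ⊆ Λ_W` give the lattice inclusion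
`(c/c₁)·Λ_{E₁} ⊆ Λ_W`, hence a `ℚ`-ISOGENY `ψ : E₁ → W` with `ψ(π₁(z)) = π_W((c/c₁)z)` on complex points
(`exists_isogeny_baseChange_apply_eq_of_forall_mul_mem_lattice`, Silverman VI.4.1 + descent, a tree theorem) commuting with `Aut(ℂ/ℚ)`
(`Isogeny.map_baseChange`); pushing Stevens' formula for `D₁` through `ψ` gives it for `D`.  (p3 gen 20 used the same isogeny to make es's SC a theorem.)

* §1 `exists_modularParametrizationData_of_gamma1` — an `X₁(N)`-datum of `W` yields an `X₀(N)`-datum of `W` with the same newform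
  (`c₀ = c·φ(N)`, `φ(N)Λ₀ ⊆ Λ₁`; degree by `exists_modularDegree_holds`); fact-free.
* §2 **`naturalTes75_of_Tes75_of_optimalTwin`** — T-es-75 ∧ (optimal twin for every `X₁(N)`-datum) ⟹ T-es-75♮.
* §3 `optimalTwin_of_modularity_CESweak` — the twin ⟸ modularity (EXO, `ExistsMinimalOptimalDatum`) ∧ CES-weak, where CES-weak
  («every lattice-optimal `X₀(N)`-datum of a globally minimal curve has an optimal `X₁(N)`-twin on SOME elliptic curve», explicit binder) follows
  from CES as typed (`cesWeak_of_CES`) and VERBATIM from p3 gen 21's CES♭ (no global minimality of `E₁`, which is exactly what CES♭ drops).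
* §4 `naturalTes75_of_modularity_CES_Tes75 : exists_isNewformOf → CES → T-es-75 → T-es-75♮` and the CES-weak form; so once CES♭ lands
  (p3 Stage 1, fact-free), T-es-75♮ ⟸ {modularity, T-es-75} and every row of `…NaturalTes75Consumers` holds with CES gone — p3's Stage 2
  (re-deriving each consumer) is subsumed: `maninConstantOne_of_modularity_CDT_Tes75_CESweak`, `shimuraKernelCyclic_of_modularity_Tes75_CESweak`.

HONEST FRAMING: CONDITIONAL glue; T-es-75, CES, modularity, CDT are statement-only printed facts, CES-weak/CES♭ an explicit binder until p3 lands it.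
Nothing about C2, Manin's conjecture or BSD is proved.  No definitions, no sorry.
[cite: SilvermanAEC2009, Thm. VI.4.1] [cite: Stevens1982, §1.3 Thm. 1.3.1 (b)] [cite: ConradEdixhovenStein2003, Thm. 1.1.3, §6.1 Lemma 6.1.6]
[cite: Knapp1993, Thm. 11.74 (c)(d)]
-/

set_option autoImplicit false
-- lint-debt: the directory name repeats the summit name (sibling precedent `ManinLocalTwoThreeNaturalTes75Consumers.lean`)
set_option linter.dupNamespace false

noncomputable section

open scoped Classical MatrixGroups ModularForm
open Complex CongruenceSubgroup UpperHalfPlane WeierstrassCurve WeierstrassCurve.Affine WeierstrassCurve.Affine.Point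
open Literature.NumberTheory.EllipticCurves Literature.NumberTheory.EllipticCurves.ModularForms
open Literature.NumberTheory.Automorphic
open Summit.BirchSwinnertonDyer.Rank1Residual.ManinAdditive

namespace Summit.BirchSwinnertonDyer.BirchSwinnertonDyer.Theorems.ManinLocalTwoThree.NaturalTes75

/-! ## §1 An `X₀(N)`-datum from an `X₁(N)`-datum (same curve, same newform) -/

/-- **An `X₁(N)`-datum of `W` yields an `X₀(N)`-datum of `W` with the same newform** (Manin constant `c·φ(N)`: `φ(N)Λ₀(f) ⊆ Λ₁(f)`
by `totient_mul_mem_periodLatticeGamma1`, so `cφ(N)·Λ₀(f) ⊆ cΛ₁(f) ⊆ Λ_W`; the `X₀(N)`-degree by `exists_modularDegree_holds`, transported along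
`ℂ/Λ_W ≃ W(ℂ)` as in `ModularParametrizationData.exists_optimalDatum'`).  Fact-free. [cite: LingOesterle1991, §1] [cite: Knapp1993, Thm. 11.74 (c)(d)] -/
theorem exists_modularParametrizationData_of_gamma1 {W : WeierstrassCurve ℚ} [W.IsElliptic] {N : ℕ} [NeZero N]
    (D : Gamma1ParametrizationData W N) :
    ∃ D₀ : ModularParametrizationData W N, D₀.f = D.f ∧ D₀.L = D.L ∧ D₀.c = D.c * (Nat.totient N : ℤ) := by
  have hc1 : D.c ≠ 0 := D.maninConstant_ne_zero
  have hφ : (Nat.totient N : ℤ) ≠ 0 := by exact_mod_cast (Nat.totient_pos.mpr (NeZero.pos N)).ne'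
  have hc0 : ((D.c * (Nat.totient N : ℤ) : ℤ) : ℂ) ≠ 0 := by exact_mod_cast mul_ne_zero hc1 hφ
  have hc : ∀ z ∈ periodLattice D.f, ((D.c * (Nat.totient N : ℤ) : ℤ) : ℂ) * z ∈ D.L.lattice := fun z hz ↦ by
    rw [Int.cast_mul, Int.cast_natCast, mul_assoc]
    exact D.smul_periodLatticeGamma1_le _ (totient_mul_mem_periodLatticeGamma1 D.f hz)
  obtain ⟨d, hd, hfin⟩ := exists_modularDegree_holds D.isNewformOf.1.ne_zero (L := D.L)
    (c := ((D.c * (Nat.totient N : ℤ) : ℤ) : ℂ)) hc0 hc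
  have hker' : D.L.lattice.toAddSubgroup = D.uniformize.ker :=
    SetLike.coe_injective (by rw [Submodule.coe_toAddSubgroup, D.ker_uniformize])
  let e : ℂ ⧸ D.L.lattice.toAddSubgroup ≃+ (W.baseChange ℂ).toAffine.Point :=
    QuotientAddGroup.liftEquiv D.L.lattice.toAddSubgroup D.uniformize_surjective hker'
  have he : ∀ x : ℂ, e.toEquiv (x : ℂ ⧸ D.L.lattice.toAddSubgroup) = D.uniformize x := fun _ ↦ rfl
  have key := (finite_setOf_card_fiberOrbits_ne_iff e.toEquiv
    (fun τ : ℍ ↦ ((((D.c * (Nat.totient N : ℤ) : ℤ) : ℂ) * eichlerIntegral D.f τ : ℂ) : ℂ ⧸ D.L.lattice.toAddSubgroup)) d).mpr hfin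
  simp only [he] at key
  exact ⟨
    { f := D.f
      isNewformOf := D.isNewformOf
      L := D.L
      isNeronLattice := D.isNeronLattice
      uniformize := D.uniformize
      ker_uniformize := D.ker_uniformize
      uniformize_surjective := D.uniformize_surjective
      uniformize_spec := D.uniformize_spec
      c := D.c * (Nat.totient N : ℤ)
      smul_periodLattice_le := hc
      deg := d
      deg_pos := hd
      deg_spec := key }, rfl, rfl, rfl⟩

/-! ## §2 The bridge: T-es-75 on an optimal twin ⟹ T-es-75♮ on every datum -/

/-- **T-es-75♮ ⟸ T-es-75 ∧ optimal twins.**  If Stevens' formula holds for OPTIMAL `X₁(N)`-data (the tree's T-es-75) and every `X₁(N)`-datum `D`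
of an elliptic `W/ℚ` has an optimal twin `D₁` on some elliptic `E₁/ℚ` with the same newform, then Stevens' formula holds for `D` itself: the
lattice inclusion `(c/c₁)Λ_{E₁} = cΛ₁(f) ⊆ Λ_W` is a `ℚ`-isogeny `ψ : E₁ → W` with `ψ(π₁ z) = π_W((c/c₁)z)`
(`exists_isogeny_baseChange_apply_eq_of_forall_mul_mem_lattice`) commuting with `Aut(ℂ/ℚ)` (`Isogeny.map_baseChange`), and
`ψ(π₁(c₁{∞,1/y})) = π_W(c{∞,1/y})`.  CONDITIONAL on T-es-75 and the twin hypothesis. [cite: SilvermanAEC2009, Thm. VI.4.1]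
[cite: Stevens1982, §1.3 Thm. 1.3.1 (b)] -/
theorem naturalTes75_of_Tes75_of_optimalTwin (hSt : optimalGamma1Parametrization_cuspInv_galoisAction)
    (hTwin : ∀ (W : WeierstrassCurve ℚ) [W.IsElliptic] {N : ℕ} [NeZero N] (D : Gamma1ParametrizationData W N),
      ∃ (E₁ : WeierstrassCurve ℚ) (_ : E₁.IsElliptic) (D₁ : Gamma1ParametrizationData E₁ N), D₁.IsOptimal ∧ D₁.f = D.f)
    (W : WeierstrassCurve ℚ) [W.IsElliptic] {N : ℕ} [NeZero N] (D : Gamma1ParametrizationData W N)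
    (σ : ℂ ≃ₐ[ℚ] ℂ) (d d' : ℤ) (hdd' : ((d * d' : ℤ) : ZMod N) = 1)
    (hσ : σ (Complex.exp (2 * Real.pi * Complex.I / N)) = Complex.exp (2 * Real.pi * Complex.I * d / N))
    (y : ℤ) (hy : y ≠ 0) :
    Affine.Point.map (W' := W) (σ : ℂ →ₐ[ℚ] ℂ) (D.uniformize ((D.c : ℂ) * modularSymbol D.f (1 / y))) =
      D.uniformize ((D.c : ℂ) * modularSymbol D.f (1 / (d' * y))) := by
  obtain ⟨E₁, hE₁, D₁, hD₁, hf⟩ := hTwin W D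
  haveI := hE₁
  -- Stevens' formula on the optimal twin
  have hK := hSt E₁ D₁ hD₁ σ d d' hdd' hσ y hy
  rw [hf] at hK
  -- the `ℚ`-isogeny `z ↦ r z`, `r = c/c₁`
  have hc₁ : D₁.c ≠ 0 := D₁.maninConstant_ne_zero
  have hc : D.c ≠ 0 := D.maninConstant_ne_zero
  set r : ℚ := (D.c : ℚ) / (D₁.c : ℚ) with hr
  have hr0 : r ≠ 0 := by rw [hr]; exact div_ne_zero (by exact_mod_cast hc) (by exact_mod_cast hc₁)
  have hrc : (r : ℂ) * (D₁.c : ℂ) = (D.c : ℂ) := by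
    have h1 : ((D₁.c : ℚ) : ℂ) ≠ 0 := by exact_mod_cast hc₁
    rw [hr]; push_cast; field_simp
  have hle : ∀ z ∈ D₁.L.lattice, (r : ℂ) * z ∈ D.L.lattice := by
    intro z hz
    obtain ⟨w, hw, hzw⟩ := hD₁ z hz
    rw [hf] at hw
    rw [hzw, ← mul_assoc, hrc]
    exact D.smul_periodLatticeGamma1_le w hw
  haveI : Algebra.IsAlgebraic ℚ (AlgebraicClosure ℚ) := AlgebraicClosure.isAlgebraic ℚ
  haveI : IsAlgClosure ℚ (AlgebraicClosure ℚ) := AlgebraicClosure.instIsAlgClosure ℚ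
  haveI : Normal ℚ (AlgebraicClosure ℚ) := IsAlgClosure.normal ℚ (AlgebraicClosure ℚ)
  letI : Algebra (AlgebraicClosure ℚ) ℂ := (IsAlgClosed.lift : AlgebraicClosure ℚ →ₐ[ℚ] ℂ).toRingHom.toAlgebra
  haveI : IsScalarTower ℚ (AlgebraicClosure ℚ) ℂ := IsScalarTower.of_algebraMap_eq' (Subsingleton.elim _ _)
  obtain ⟨ψ, hψ, -, -⟩ := exists_isogeny_baseChange_apply_eq_of_forall_mul_mem_lattice
    D₁.isNeronLattice.1 D₁.isNeronLattice.2 D.isNeronLattice.1 D.isNeronLattice.2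
    D₁.ker_uniformize D₁.uniformize_surjective D₁.uniformize_spec D.ker_uniformize D.uniformize_spec hr0 hle
  -- Galois equivariance of `ψ_ℂ`
  set τ₀ : AlgebraicClosure ℚ ≃ₐ[ℚ] AlgebraicClosure ℚ := σ.restrictNormal (AlgebraicClosure ℚ) with hτ₀
  have hστ : ∀ a : AlgebraicClosure ℚ, (σ : ℂ →ₐ[ℚ] ℂ) (algebraMap (AlgebraicClosure ℚ) ℂ a) =
      algebraMap (AlgebraicClosure ℚ) ℂ (Field.absoluteGaloisGroup.toAlgEquiv ℚ ((Field.absoluteGaloisGroup.toAlgEquiv ℚ).symm τ₀) a) := by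
    intro a
    rw [MulEquiv.apply_symm_apply, hτ₀]
    exact (AlgEquiv.restrictNormal_commutes σ (AlgebraicClosure ℚ) a).symm
  have hequiv : ∀ P : (E₁.baseChange ℂ).toAffine.Point,
      Affine.Point.map (W' := W) (σ : ℂ →ₐ[ℚ] ℂ) (ψ.baseChange (M := ℂ) P) =
        ψ.baseChange (M := ℂ) (Affine.Point.map (W' := E₁) (σ : ℂ →ₐ[ℚ] ℂ) P) :=
    fun P ↦ ψ.map_baseChange (σ : ℂ →ₐ[ℚ] ℂ) ((Field.absoluteGaloisGroup.toAlgEquiv ℚ).symm τ₀) hστ P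
  -- push Stevens' formula through `ψ_ℂ`
  have hK' := congrArg (ψ.baseChange (M := ℂ)) hK
  rw [← hequiv, hψ, hψ, ← mul_assoc, ← mul_assoc, hrc] at hK'
  exact hK'

/-! ## §3 The optimal twin from modularity and CES-weak -/

/-- **CES-weak from CES as typed**: every lattice-optimal `X₀(N)`-datum of a globally minimal curve has an optimal `X₁(N)`-twin with the same newform
on some elliptic curve (CES gives it on a globally minimal `ℚ`-isogenous curve; the newform agrees by `Gamma1ParametrizationData.f_eq_of_isIsogenous`).
[cite: ConradEdixhovenStein2003, Thm. 1.1.3, §6.1 Lemma 6.1.6] -/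
theorem cesWeak_of_CES (hCES : exists_optimal_gamma1ParametrizationData) :
    ∀ (W₀ : WeierstrassCurve ℚ) [W₀.IsElliptic] [W₀.IsGloballyMinimal] {N : ℕ} [NeZero N] (D₀ : ModularParametrizationData W₀ N),
      (∀ z ∈ D₀.L.lattice, ∃ w ∈ periodLattice D₀.f, z = D₀.c * w) →
      ∃ (E₁ : WeierstrassCurve ℚ) (_ : E₁.IsElliptic) (D₁ : Gamma1ParametrizationData E₁ N), D₁.IsOptimal ∧ D₁.f = D₀.f := by
  intro W₀ _ _ N _ D₀ hopt
  obtain ⟨W₁, hW₁, _, D₁, hiso, hD₁⟩ := hCES W₀ D₀ hopt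
  haveI := hW₁
  exact ⟨W₁, hW₁, D₁, hD₁, D₁.f_eq_of_isIsogenous D₀ hiso⟩

/-- **The optimal twin for every `X₁(N)`-datum ⟸ modularity ∧ CES-weak**: `X₁(N)`-datum of `W` ⟹ `X₀(N)`-datum of `W` (§1) ⟹ lattice-optimal
`X₀(N)`-datum of a globally minimal curve with the same newform (EXO ⟸ modularity, `ExistsMinimalOptimalDatum.existsMinimalOptimalDatum_of_modularity`)
⟹ CES-weak.  CONDITIONAL. [cite: ConradEdixhovenStein2003, Thm. 1.1.3] [cite: Knapp1993, Prop. 12.9(a)] -/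
theorem optimalTwin_of_modularity_CESweak (hnf : exists_isNewformOf)
    (hCESw : ∀ (W₀ : WeierstrassCurve ℚ) [W₀.IsElliptic] [W₀.IsGloballyMinimal] {N : ℕ} [NeZero N] (D₀ : ModularParametrizationData W₀ N),
      (∀ z ∈ D₀.L.lattice, ∃ w ∈ periodLattice D₀.f, z = D₀.c * w) →
      ∃ (E₁ : WeierstrassCurve ℚ) (_ : E₁.IsElliptic) (D₁ : Gamma1ParametrizationData E₁ N), D₁.IsOptimal ∧ D₁.f = D₀.f)
    (W : WeierstrassCurve ℚ) [W.IsElliptic] {N : ℕ} [NeZero N] (D : Gamma1ParametrizationData W N) :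
    ∃ (E₁ : WeierstrassCurve ℚ) (_ : E₁.IsElliptic) (D₁ : Gamma1ParametrizationData E₁ N), D₁.IsOptimal ∧ D₁.f = D.f := by
  obtain ⟨D', hf', -, -⟩ := exists_modularParametrizationData_of_gamma1 D
  obtain ⟨W₀, _, _, D₀, hf₀, hopt⟩ := ExistsMinimalOptimalDatum.existsMinimalOptimalDatum_of_modularity hnf W D'
  obtain ⟨E₁, hE₁, D₁, hD₁, hf₁⟩ := hCESw W₀ D₀ hopt
  exact ⟨E₁, hE₁, D₁, hD₁, by rw [hf₁, hf₀, hf']⟩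

/-! ## §4 Headline corollaries -/

/-- **T-es-75♮ ⟸ {modularity, CES-weak, T-es-75}** (so ⟸ {modularity, T-es-75} once p3's CES♭ lands fact-free).  CONDITIONAL.
[cite: Stevens1982, §1.3 Thm. 1.3.1 (b)] [cite: SilvermanAEC2009, Thm. VI.4.1] -/
theorem naturalTes75_of_modularity_CESweak_Tes75 (hnf : exists_isNewformOf)
    (hCESw : ∀ (W₀ : WeierstrassCurve ℚ) [W₀.IsElliptic] [W₀.IsGloballyMinimal] {N : ℕ} [NeZero N] (D₀ : ModularParametrizationData W₀ N),
      (∀ z ∈ D₀.L.lattice, ∃ w ∈ periodLattice D₀.f, z = D₀.c * w) →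
      ∃ (E₁ : WeierstrassCurve ℚ) (_ : E₁.IsElliptic) (D₁ : Gamma1ParametrizationData E₁ N), D₁.IsOptimal ∧ D₁.f = D₀.f)
    (hSt : optimalGamma1Parametrization_cuspInv_galoisAction)
    (W : WeierstrassCurve ℚ) [W.IsElliptic] {N : ℕ} [NeZero N] (D : Gamma1ParametrizationData W N)
    (σ : ℂ ≃ₐ[ℚ] ℂ) (d d' : ℤ) (hdd' : ((d * d' : ℤ) : ZMod N) = 1)
    (hσ : σ (Complex.exp (2 * Real.pi * Complex.I / N)) = Complex.exp (2 * Real.pi * Complex.I * d / N))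
    (y : ℤ) (hy : y ≠ 0) :
    Affine.Point.map (W' := W) (σ : ℂ →ₐ[ℚ] ℂ) (D.uniformize ((D.c : ℂ) * modularSymbol D.f (1 / y))) =
      D.uniformize ((D.c : ℂ) * modularSymbol D.f (1 / (d' * y))) :=
  naturalTes75_of_Tes75_of_optimalTwin hSt (fun W _ _ _ D ↦ optimalTwin_of_modularity_CESweak hnf hCESw W D) W D σ d d' hdd' hσ y hy

/-- **T-es-75♮ ⟸ {modularity, CES, T-es-75}** (three statement-only printed facts). CONDITIONAL. [cite: Stevens1982, §1.3 Thm. 1.3.1 (b)]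
[cite: ConradEdixhovenStein2003, Thm. 1.1.3] -/
theorem naturalTes75_of_modularity_CES_Tes75 (hnf : exists_isNewformOf) (hCES : exists_optimal_gamma1ParametrizationData)
    (hSt : optimalGamma1Parametrization_cuspInv_galoisAction)
    (W : WeierstrassCurve ℚ) [W.IsElliptic] {N : ℕ} [NeZero N] (D : Gamma1ParametrizationData W N)
    (σ : ℂ ≃ₐ[ℚ] ℂ) (d d' : ℤ) (hdd' : ((d * d' : ℤ) : ZMod N) = 1)
    (hσ : σ (Complex.exp (2 * Real.pi * Complex.I / N)) = Complex.exp (2 * Real.pi * Complex.I * d / N))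
    (y : ℤ) (hy : y ≠ 0) :
    Affine.Point.map (W' := W) (σ : ℂ →ₐ[ℚ] ℂ) (D.uniformize ((D.c : ℂ) * modularSymbol D.f (1 / y))) =
      D.uniformize ((D.c : ℂ) * modularSymbol D.f (1 / (d' * y))) :=
  naturalTes75_of_modularity_CESweak_Tes75 hnf (cesWeak_of_CES hCES) hSt W D σ d d' hdd' hσ y hy

/-- **Manin's conjecture leaf `ManinConstantOne` ⟸ {modularity, CDT, T-es-75, CES-weak}** (`maninConstantOne_of_modularity_CDT_naturalTes75` over the
bridge); with p3's CES♭ this is ⟸ {modularity, CDT, T-es-75}.  CONDITIONAL; Manin's conjecture and BSD are NOT proved.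
[cite: CalegariDimitrovTang2025, Thm. 1.0.1] [cite: Stevens1982, §1.3 Thm. 1.3.1 (b)] -/
theorem maninConstantOne_of_modularity_CDT_Tes75_CESweak (hnf : exists_isNewformOf) (hCDT : CalegariDimitrovTang2025_unboundedDenominators)
    (hSt : optimalGamma1Parametrization_cuspInv_galoisAction)
    (hCESw : ∀ (W₀ : WeierstrassCurve ℚ) [W₀.IsElliptic] [W₀.IsGloballyMinimal] {N : ℕ} [NeZero N] (D₀ : ModularParametrizationData W₀ N),
      (∀ z ∈ D₀.L.lattice, ∃ w ∈ periodLattice D₀.f, z = D₀.c * w) →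
      ∃ (E₁ : WeierstrassCurve ℚ) (_ : E₁.IsElliptic) (D₁ : Gamma1ParametrizationData E₁ N), D₁.IsOptimal ∧ D₁.f = D₀.f) :
    Summit.BirchSwinnertonDyer.Rank1Residual.ManinConstant.ManinConstantOne :=
  maninConstantOne_of_modularity_CDT_naturalTes75
    (fun W _ _ _ D σ d d' hdd' hσ y hy ↦ naturalTes75_of_modularity_CESweak_Tes75 hnf hCESw hSt W D σ d d' hdd' hσ y hy) hnf hCDT

/-- **desc row 2 `ShimuraKernelCyclic` ⟸ {modularity, T-es-75, CES-weak}** (with CES♭: ⟸ {modularity, T-es-75}).  CONDITIONAL. [cite: Vatsal2005, Conj. 1.9] -/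
theorem shimuraKernelCyclic_of_modularity_Tes75_CESweak (hnf : exists_isNewformOf) (hSt : optimalGamma1Parametrization_cuspInv_galoisAction)
    (hCESw : ∀ (W₀ : WeierstrassCurve ℚ) [W₀.IsElliptic] [W₀.IsGloballyMinimal] {N : ℕ} [NeZero N] (D₀ : ModularParametrizationData W₀ N),
      (∀ z ∈ D₀.L.lattice, ∃ w ∈ periodLattice D₀.f, z = D₀.c * w) →
      ∃ (E₁ : WeierstrassCurve ℚ) (_ : E₁.IsElliptic) (D₁ : Gamma1ParametrizationData E₁ N), D₁.IsOptimal ∧ D₁.f = D₀.f) :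
    ShimuraCyclic.ShimuraKernelCyclic :=
  shimuraKernelCyclic_of_modularity_naturalTes75
    (fun W _ _ _ D σ d d' hdd' hσ y hy ↦ naturalTes75_of_modularity_CESweak_Tes75 hnf hCESw hSt W D σ d d' hdd' hσ y hy) hnf

end Summit.BirchSwinnertonDyer.BirchSwinnertonDyer.Theorems.ManinLocalTwoThree.NaturalTes75

end
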